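import Literature.NumberTheory.Automorphic.IwahoriFactorizationGL
import Literature.NumberTheory.Automorphic.HeckeAlgebra
import HarnessLib

/-!
# Multiplicativity of the `K₁`-double-coset operators of dominant torus elements

Topic `NumberTheory/Automorphic`; theorems only (no definition, no named fact).

## Abstract part (any group)

Let `G` be a group, `K, P ≤ G` subgroups and `t, t' ∈ P`. Suppose that `t` and `t'` *contract*
`K ∩ P` into `K` (`t (K ∩ P) t⁻¹ ⊆ K`, likewise for `t'`), that the left cosets in `K t K` and
`K t' K` admit transversals `s ⊆ (K ∩ P) t`, `s' ⊆ (K ∩ P) t'` (*`P`-transversals*), and that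
every coset `k t t' K`, `k ∈ K`, has a representative in `K t t'` of the form `b t t'`, `b ∈ K`
with `(b t t')⁻¹ k t t' ∈ K` — the three consequences of an Iwahori factorisation
`K = (K ∩ P)(K ∩ P⁻)` with `t⁻¹ (K ∩ P⁻) t ⊆ K`. Then (`bijOn_image_mul_orbit`) the products
`x y`, `x ∈ s`, `y ∈ s'`, are pairwise distinct and form a transversal of `K t t' K / K`, so that
for the finite-sum Hecke operators `[K g K] = heckeOperator ρ K g` of `HeckeAlgebra` on the
`K`-fixed vectors of any representation `ρ` of `G`,

`[K t K] ([K t' K] z) = [K t t' K] z` (`heckeOperator_mul_of_transversal`).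

## `GL_n`

For a non-archimedean local field `F`, a uniformizing element `ϖ`, `K = K₁ = 1 + 𝓂 M_n(𝒪)`
(`proUnipotentGL n F 0`, `IwahoriGL`), `P = B` the upper triangular Borel
(`standardParabolicGL F id`) and the torus elements `ϖ^m = zpowDiagGL _ m` with `m ∈ ℤⁿ`
**dominant** (antitone, `m_1 ≥ ⋯ ≥ m_n`), the hypotheses hold by `IwahoriFactorizationGL`
(`conj_mem_congruenceOne_inf_upper`, `exists_upper_mul_zpowDiagGL_coset_eq`), `K₁ g K₁ / K₁` is
finite (`finite_orbit_congruenceOne`, `K₁` compact open), and `P`-transversals exist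
(`exists_borel_transversal_congruenceOne`). Hence (**`heckeOperator_congruenceOne_mul`**) on
`V^{K₁}`

`[K₁ ϖ^m K₁] ∘ [K₁ ϖ^{m'} K₁] = [K₁ ϖ^{m + m'} K₁]` for dominant `m, m'`.

This is the multiplicativity of dominant translations in Iwahori–Hecke algebras
(Iwahori–Matsumoto (1965), §3, Prop. 3.2 with Th. 3.3: `ind(σ) = q^{λ(σ)}` and
`S_σ = S_{w_1} ⋯ S_{w_r}` along reduced expressions, so that `S_d S_{d'} = S_{d d'}` for `d, d'`
in the dominant chamber, for the Iwahori subgroup `B`; Casselman (1995), §4.1, for congruence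
subgroups with an Iwahori factorisation: `K a K · K b K = K a b K` with matching indices for
`a, b` dominant), written for the explicit finite-sum Hecke operators of the tree. It is the
input for the exponential growth bound of spherical matrix coefficients of admissible
representations (`SphericalCoefficientGrowth`), hence for Godement–Jacquet's Lemma 6.10 for
admissible (not necessarily unitary) representations.

## References

* N. Iwahori, H. Matsumoto, *On some Bruhat decomposition and the structure of the Hecke rings
  of p-adic Chevalley groups*, Publ. Math. IHÉS 25 (1965), §3, Prop. 3.2, Th. 3.3 (pp. 276–277
  of the journal pagination; read) [IwahoriMatsumoto1965].
* W. Casselman, *Introduction to the theory of admissible representations of `p`-adic reductive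
  groups*, unpublished notes (draft 1 May 1995), §1.4, §4.1 [Casselman1995].
-/

noncomputable section

open Matrix ValuativeRel MulAction

namespace Literature.NumberTheory.Automorphic

/-! ### Abstract part: products of `P`-transversals -/

section Abstract

variable {G : Type*} [Group G] {K P : Subgroup G} {t t' : G}

/-- The action of `k ∈ K` on `g K` is `(k g) K`. [folklore] -/
theorem subgroup_smul_coe (k : K) (g : G) :
    k • (g : G ⧸ K) = (((k : G) * g : G) : G ⧸ K) :=
  rfl

/-- **Injectivity of the product of `P`-transversals**: if `x₁, x₂ ∈ P t` and
`y₁, y₂ ∈ (K ∩ P) t'` with `t'` contracting `K ∩ P` into `K`, then `x₁ y₁ K = x₂ y₂ K` forces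
`x₁ K = x₂ K`, and then `x₁ = x₂` forces `y₁ K = y₂ K`: the element
`q = (x₁ y₁)⁻¹ x₂ y₂ ∈ K ∩ P` has `t' q t'⁻¹ = c₁⁻¹ (x₁⁻¹ x₂) c₂ ∈ K` with
`cᵢ = yᵢ t'⁻¹ ∈ K`. [folklore] -/
theorem coe_eq_and_coe_eq_of_coe_mul_eq (ht : t ∈ P) (ht' : t' ∈ P)
    (hcontr' : ∀ q, q ∈ K → q ∈ P → t' * q * t'⁻¹ ∈ K) {x₁ x₂ y₁ y₂ : G}
    (hx₁ : x₁ * t⁻¹ ∈ P) (hx₂ : x₂ * t⁻¹ ∈ P) (hy₁ : y₁ * t'⁻¹ ∈ K ∧ y₁ * t'⁻¹ ∈ P)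
    (hy₂ : y₂ * t'⁻¹ ∈ K ∧ y₂ * t'⁻¹ ∈ P)
    (h : ((x₁ * y₁ : G) : G ⧸ K) = ((x₂ * y₂ : G) : G ⧸ K)) :
    ((x₁ : G ⧸ K) = (x₂ : G ⧸ K)) ∧ (x₁ = x₂ → (y₁ : G ⧸ K) = (y₂ : G ⧸ K)) := by
  have hP : ∀ {x u : G}, x * u⁻¹ ∈ P → u ∈ P → x ∈ P := fun {x u} hx hu => by
    have e : x = x * u⁻¹ * u := by rw [inv_mul_cancel_right]
    rw [e]; exact Subgroup.mul_mem _ hx hu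
  set q : G := (x₁ * y₁)⁻¹ * (x₂ * y₂) with hq
  have hqK : q ∈ K := QuotientGroup.eq.mp h
  have hqP : q ∈ P :=
    Subgroup.mul_mem _ (Subgroup.inv_mem _ (Subgroup.mul_mem _ (hP hx₁ ht) (hP hy₁.2 ht')))
      (Subgroup.mul_mem _ (hP hx₂ ht) (hP hy₂.2 ht'))
  have hconj := hcontr' q hqK hqP
  have e : t' * q * t'⁻¹ = (y₁ * t'⁻¹)⁻¹ * (x₁⁻¹ * x₂) * (y₂ * t'⁻¹) := by rw [hq]; group
  rw [e] at hconj
  have hx : x₁⁻¹ * x₂ ∈ K := by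
    have e2 : x₁⁻¹ * x₂ =
        (y₁ * t'⁻¹) * ((y₁ * t'⁻¹)⁻¹ * (x₁⁻¹ * x₂) * (y₂ * t'⁻¹)) * (y₂ * t'⁻¹)⁻¹ := by group
    rw [e2]
    exact Subgroup.mul_mem _ (Subgroup.mul_mem _ hy₁.1 hconj) (Subgroup.inv_mem _ hy₂.1)
  refine ⟨QuotientGroup.eq.mpr hx, fun hxx => QuotientGroup.eq.mpr ?_⟩
  subst hxx
  have e3 : y₁⁻¹ * y₂ = q := by rw [hq]; group
  rwa [e3]

/-- **Products of `P`-representatives lie in `K t t' K`**: for `x = b t` (`b ∈ K`) and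
`y = c t'` (`c ∈ K ∩ P`), `x y = (b · t c t⁻¹) t t'` with `t c t⁻¹ ∈ K`. [folklore] -/
theorem coe_mul_mem_orbit (hcontr : ∀ q, q ∈ K → q ∈ P → t * q * t⁻¹ ∈ K) {x y : G}
    (hx : x * t⁻¹ ∈ K) (hy : y * t'⁻¹ ∈ K ∧ y * t'⁻¹ ∈ P) :
    ((x * y : G) : G ⧸ K) ∈ orbit K ((t * t' : G) : G ⧸ K) := by
  have hk : x * t⁻¹ * (t * (y * t'⁻¹) * t⁻¹) ∈ K := Subgroup.mul_mem _ hx (hcontr _ hy.1 hy.2)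
  refine MulAction.mem_orbit_iff.mpr ⟨⟨_, hk⟩, ?_⟩
  rw [subgroup_smul_coe]
  congr 1
  change x * t⁻¹ * (t * (y * t'⁻¹) * t⁻¹) * (t * t') = x * y
  group

/-- **Surjectivity of the product of transversals**: if every coset `k t t' K` (`k ∈ K`) is
`b t t' K` for some `b ∈ K`, then it is `x y K` for `x ∈ s`, `y ∈ s'` (transversals of
`K t K / K` and `K t' K / K`): choose `x` with `x K = b t K`, so that `r = x⁻¹ b t ∈ K`, and `y`
with `y K = r t' K`. [folklore] -/
theorem exists_coe_mul_eq_of_mem_orbit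
    (hrep : ∀ k, k ∈ K → ∃ b, b ∈ K ∧ (b * (t * t'))⁻¹ * (k * (t * t')) ∈ K)
    {s s' : Finset G}
    (hbij : Set.BijOn (fun x : G => (x : G ⧸ K)) s (orbit K (t : G ⧸ K)))
    (hbij' : Set.BijOn (fun x : G => (x : G ⧸ K)) s' (orbit K (t' : G ⧸ K))) {γ : G ⧸ K}
    (hγ : γ ∈ orbit K ((t * t' : G) : G ⧸ K)) :
    ∃ x ∈ s, ∃ y ∈ s', ((x * y : G) : G ⧸ K) = γ := by
  obtain ⟨k, rfl⟩ := MulAction.mem_orbit_iff.mp hγ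
  obtain ⟨b, hbK, hbt⟩ := hrep k k.2
  have h1 : ((b * t : G) : G ⧸ K) ∈ orbit K (t : G ⧸ K) :=
    MulAction.mem_orbit_iff.mpr ⟨⟨b, hbK⟩, rfl⟩
  obtain ⟨x, hxs, hx⟩ := hbij.surjOn h1
  have hr : x⁻¹ * (b * t) ∈ K := QuotientGroup.eq.mp hx
  have h2 : ((x⁻¹ * (b * t) * t' : G) : G ⧸ K) ∈ orbit K (t' : G ⧸ K) :=
    MulAction.mem_orbit_iff.mpr ⟨⟨_, hr⟩, rfl⟩
  obtain ⟨y, hys, hy⟩ := hbij'.surjOn h2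
  refine ⟨x, hxs, y, hys, ?_⟩
  rw [subgroup_smul_coe]
  calc ((x * y : G) : G ⧸ K)
      = ((x * (x⁻¹ * (b * t) * t') : G) : G ⧸ K) := by
        refine QuotientGroup.eq.mpr ?_
        have e : (x * y)⁻¹ * (x * (x⁻¹ * (b * t) * t')) = y⁻¹ * (x⁻¹ * (b * t) * t') := by
          group
        rw [e]
        exact QuotientGroup.eq.mp hy
    _ = ((b * (t * t') : G) : G ⧸ K) := by congr 1; group
    _ = (((k : G) * (t * t') : G) : G ⧸ K) := QuotientGroup.eq.mpr hbt

/-- **The product of `P`-transversals is a transversal of `K t t' K / K`**: under the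
contraction and representative hypotheses, `(x, y) ↦ x y` is injective on `s × s'` and its image
represents each left coset of `K t t' K` exactly once. Coset-level content of
`K t K · K t' K = K t t' K` with multiplicity one (Iwahori–Matsumoto (1965), §3, Prop. 3.2
and Th. 3.3; Casselman (1995), §4.1). [cite: IwahoriMatsumoto1965, §3 Prop. 3.2] -/
theorem bijOn_image_mul_orbit [DecidableEq G] (ht : t ∈ P) (ht' : t' ∈ P)
    (hcontr : ∀ q, q ∈ K → q ∈ P → t * q * t⁻¹ ∈ K)
    (hcontr' : ∀ q, q ∈ K → q ∈ P → t' * q * t'⁻¹ ∈ K)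
    (hrep : ∀ k, k ∈ K → ∃ b, b ∈ K ∧ (b * (t * t'))⁻¹ * (k * (t * t')) ∈ K)
    {s s' : Finset G} (hs : ∀ x ∈ s, x * t⁻¹ ∈ K ∧ x * t⁻¹ ∈ P)
    (hs' : ∀ y ∈ s', y * t'⁻¹ ∈ K ∧ y * t'⁻¹ ∈ P)
    (hbij : Set.BijOn (fun x : G => (x : G ⧸ K)) s (orbit K (t : G ⧸ K)))
    (hbij' : Set.BijOn (fun x : G => (x : G ⧸ K)) s' (orbit K (t' : G ⧸ K))) :
    (∀ p ∈ s ×ˢ s', ∀ p' ∈ s ×ˢ s', p.1 * p.2 = p'.1 * p'.2 → p = p') ∧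
    Set.BijOn (fun x : G => (x : G ⧸ K)) ((s ×ˢ s').image fun p => p.1 * p.2)
      (orbit K ((t * t' : G) : G ⧸ K)) := by
  -- the key: equal cosets of products force equal factors
  have key : ∀ p ∈ s ×ˢ s', ∀ p' ∈ s ×ˢ s',
      ((p.1 * p.2 : G) : G ⧸ K) = ((p'.1 * p'.2 : G) : G ⧸ K) → p = p' := by
    intro p hp p' hp' h
    rw [Finset.mem_product] at hp hp'
    obtain ⟨h1, h2⟩ := coe_eq_and_coe_eq_of_coe_mul_eq ht ht' hcontr' (hs _ hp.1).2
      (hs _ hp'.1).2 (hs' _ hp.2) (hs' _ hp'.2) h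
    have e1 : p.1 = p'.1 := hbij.injOn hp.1 hp'.1 h1
    exact Prod.ext e1 (hbij'.injOn hp.2 hp'.2 (h2 e1))
  refine ⟨fun p hp p' hp' h => key p hp p' hp' (by rw [h]), ?_, ?_, ?_⟩
  · intro w hw
    obtain ⟨p, hp, rfl⟩ := Finset.mem_image.mp hw
    rw [Finset.mem_product] at hp
    exact coe_mul_mem_orbit hcontr (hs _ hp.1).1 (hs' _ hp.2)
  · intro w hw w' hw' h
    obtain ⟨p, hp, rfl⟩ := Finset.mem_image.mp hw
    obtain ⟨p', hp', rfl⟩ := Finset.mem_image.mp hw'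
    rw [key p hp p' hp' h]
  · intro γ hγ
    obtain ⟨x, hx, y, hy, h⟩ := exists_coe_mul_eq_of_mem_orbit hrep hbij hbij' hγ
    exact ⟨x * y, Finset.mem_coe.mpr (Finset.mem_image.mpr ⟨(x, y),
      Finset.mem_product.mpr ⟨hx, hy⟩, rfl⟩), h⟩

variable {k V : Type*} [CommRing k] [AddCommGroup V] [Module k V] (ρ : Representation k G V)

/-- **Multiplicativity of double-coset operators from a product transversal.** Under the
contraction and representative hypotheses (an Iwahori factorisation of `K` relative to `P` and
elements `t, t'` dominant for it) and if `K t' K / K` is finite, the Hecke operators of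
`HeckeAlgebra` satisfy `[K t K] ([K t' K] z) = [K t t' K] z` on `K`-fixed `z`: with
`P`-transversals `s ∋ x`, `s' ∋ y` the left side is `∑_{x, y} ρ(x y) z`, and the `x y` form a
transversal of `K t t' K / K`. (Iwahori–Matsumoto (1965), §3, Prop. 3.2 and Th. 3.3;
Casselman (1995), §4.1.) [cite: IwahoriMatsumoto1965, §3 Prop. 3.2] -/
theorem heckeOperator_mul_of_transversal (ht : t ∈ P) (ht' : t' ∈ P)
    (hcontr : ∀ q, q ∈ K → q ∈ P → t * q * t⁻¹ ∈ K)
    (hcontr' : ∀ q, q ∈ K → q ∈ P → t' * q * t'⁻¹ ∈ K)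
    (hrep : ∀ k, k ∈ K → ∃ b, b ∈ K ∧ (b * (t * t'))⁻¹ * (k * (t * t')) ∈ K)
    {s s' : Finset G} (hs : ∀ x ∈ s, x * t⁻¹ ∈ K ∧ x * t⁻¹ ∈ P)
    (hs' : ∀ y ∈ s', y * t'⁻¹ ∈ K ∧ y * t'⁻¹ ∈ P)
    (hbij : Set.BijOn (fun x : G => (x : G ⧸ K)) s (orbit K (t : G ⧸ K)))
    (hbij' : Set.BijOn (fun x : G => (x : G ⧸ K)) s' (orbit K (t' : G ⧸ K)))
    (hfin' : (orbit K (t' : G ⧸ K)).Finite) {z : V} (hz : z ∈ ρ.fixedPoints K) :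
    heckeOperator ρ K t (heckeOperator ρ K t' z) = heckeOperator ρ K (t * t') z := by
  classical
  obtain ⟨hinj, hbij''⟩ := bijOn_image_mul_orbit ht ht' hcontr hcontr' hrep hs hs' hbij hbij'
  have hz' : heckeOperator ρ K t' z ∈ ρ.fixedPoints K :=
    heckeOperator_apply_mem_fixedPoints ρ K _ hz hfin'
  rw [heckeOperator_apply_eq_sum ρ K _ s hbij hz', heckeOperator_apply_eq_sum ρ K _ s' hbij' hz,
    heckeOperator_apply_eq_sum ρ K _ _ hbij'' hz, Finset.sum_image hinj, Finset.sum_product]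
  refine Finset.sum_congr rfl fun x _ => ?_
  rw [map_sum]
  refine Finset.sum_congr rfl fun y _ => ?_
  rw [map_mul, Module.End.mul_apply]

end Abstract

/-! ### `GL_n`: the first congruence subgroup and dominant torus elements -/

section GeneralLinear

variable {n : ℕ} {F : Type*} [Field F] [ValuativeRel F] [TopologicalSpace F]
  [IsNonarchimedeanLocalField F] {ϖ : F}

variable (n F) in
/-- `K₁` is compact open, so `(K₁, G, K₁)` is a Hecke pair: every double coset `K₁ g K₁` is a
finite union of left cosets. [folklore] -/
theorem isHeckeTriple_congruenceOne :
    IsHeckeTriple (⊤ : Submonoid (GL (Fin n) F)) (proUnipotentGL n F (0 : Fin n → Fin 1))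
      (proUnipotentGL n F (0 : Fin n → Fin 1)) :=
  isHeckeTriple_top_of_isCompact_isOpen _ (isCompact_proUnipotentGL n F _)
    (isOpen_proUnipotentGL n F _)

/-- The `K₁`-orbit of `g K₁` in `G ⧸ K₁` (i.e. `K₁ g K₁ / K₁`) is finite. [folklore] -/
theorem finite_orbit_congruenceOne (g : GL (Fin n) F) :
    (orbit (proUnipotentGL n F (0 : Fin n → Fin 1))
      (g : GL (Fin n) F ⧸ proUnipotentGL n F (0 : Fin n → Fin 1))).Finite :=
  haveI := isHeckeTriple_congruenceOne n F
  finite_orbit_quotient _ g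

omit [TopologicalSpace F] [IsNonarchimedeanLocalField F] in
/-- Dominant `ϖ^m` contracts `K₁ ∩ B` into `K₁` (restatement of
`conj_mem_congruenceOne_inf_upper` with `t⁻¹`). [cite: Casselman1995, Prop. 1.4.3] -/
theorem zpowDiagGL_mul_mul_inv_mem_congruenceOne (hϖ : IsUniformizingElement ϖ)
    {m : Fin n → ℤ} (hm : Antitone m) (q : GL (Fin n) F)
    (hqK : q ∈ proUnipotentGL n F (0 : Fin n → Fin 1))
    (hqB : q ∈ standardParabolicGL F (id : Fin n → Fin n)) :
    zpowDiagGL hϖ.ne_zero m * q * (zpowDiagGL hϖ.ne_zero m)⁻¹ ∈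
      proUnipotentGL n F (0 : Fin n → Fin 1) := by
  rw [← zpowDiagGL_neg]
  exact (conj_mem_congruenceOne_inf_upper hϖ hm hqK hqB).1

/-- **Borel transversals of `K₁ ϖ^m K₁ / K₁`** (`m` dominant): there is a finite set `s` of
representatives of the left cosets in `K₁ ϖ^m K₁`, each of the form `x = b ϖ^m` with
`b ∈ K₁ ∩ B` (`exists_upper_mul_zpowDiagGL_coset_eq`: Iwahori factorisation of `K₁` and
`ϖ^{-m} (K₁ ∩ B⁻) ϖ^m ⊆ K₁`). [cite: Casselman1995, Prop. 1.4.4] -/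
theorem exists_borel_transversal_congruenceOne (hϖ : IsUniformizingElement ϖ) {m : Fin n → ℤ}
    (hm : Antitone m) :
    ∃ s : Finset (GL (Fin n) F),
      (∀ x ∈ s, x * (zpowDiagGL hϖ.ne_zero m)⁻¹ ∈ proUnipotentGL n F (0 : Fin n → Fin 1) ∧
        x * (zpowDiagGL hϖ.ne_zero m)⁻¹ ∈ standardParabolicGL F (id : Fin n → Fin n)) ∧
      Set.BijOn
        (fun x : GL (Fin n) F => (x : GL (Fin n) F ⧸ proUnipotentGL n F (0 : Fin n → Fin 1)))
        s (orbit (proUnipotentGL n F (0 : Fin n → Fin 1))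
          (zpowDiagGL hϖ.ne_zero m : GL (Fin n) F ⧸ proUnipotentGL n F (0 : Fin n → Fin 1))) := by
  classical
  set K : Subgroup (GL (Fin n) F) := proUnipotentGL n F (0 : Fin n → Fin 1) with hK
  set t : GL (Fin n) F := zpowDiagGL hϖ.ne_zero m with ht
  -- a Borel representative for every coset of the orbit
  have key : ∀ γ : GL (Fin n) F ⧸ K, ∃ x : GL (Fin n) F, γ ∈ orbit K (t : GL (Fin n) F ⧸ K) →
      (x * t⁻¹ ∈ K ∧ x * t⁻¹ ∈ standardParabolicGL F (id : Fin n → Fin n)) ∧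
        (x : GL (Fin n) F ⧸ K) = γ := by
    intro γ
    by_cases hγ : γ ∈ orbit K (t : GL (Fin n) F ⧸ K)
    · obtain ⟨k, rfl⟩ := MulAction.mem_orbit_iff.mp hγ
      obtain ⟨b, hbK, hbB, hbt⟩ := exists_upper_mul_zpowDiagGL_coset_eq hϖ hm k.2
      refine ⟨b * t, fun _ => ⟨?_, ?_⟩⟩
      · rw [mul_inv_cancel_right]; exact ⟨hbK, hbB⟩
      · rw [subgroup_smul_coe]
        exact QuotientGroup.eq.mpr hbt
    · exact ⟨1, fun h => (hγ h).elim⟩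
  choose f hf using key
  have hfin : (orbit K (t : GL (Fin n) F ⧸ K)).Finite := finite_orbit_congruenceOne t
  refine ⟨hfin.toFinset.image f, fun x hx => ?_, ?_, ?_, ?_⟩
  · obtain ⟨γ, hγ, rfl⟩ := Finset.mem_image.mp hx
    exact ((hf γ) (hfin.mem_toFinset.mp hγ)).1
  · intro x hx
    obtain ⟨γ, hγ, rfl⟩ := Finset.mem_image.mp hx
    have hγ' := hfin.mem_toFinset.mp hγ
    change (f γ : GL (Fin n) F ⧸ K) ∈ _
    rw [((hf γ) hγ').2]
    exact hγ'
  · intro x hx y hy hxy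
    obtain ⟨γ, hγ, rfl⟩ := Finset.mem_image.mp hx
    obtain ⟨δ, hδ, rfl⟩ := Finset.mem_image.mp hy
    have h1 := ((hf γ) (hfin.mem_toFinset.mp hγ)).2
    have h2 := ((hf δ) (hfin.mem_toFinset.mp hδ)).2
    change (f γ : GL (Fin n) F ⧸ K) = (f δ : GL (Fin n) F ⧸ K) at hxy
    rw [h1, h2] at hxy
    rw [hxy]
  · intro γ hγ
    exact ⟨f γ, Finset.mem_coe.mpr (Finset.mem_image.mpr ⟨γ, hfin.mem_toFinset.mpr hγ, rfl⟩),
      ((hf γ) hγ).2⟩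

variable {k V : Type*} [CommRing k] [AddCommGroup V] [Module k V]
  (ρ : Representation k (GL (Fin n) F) V)

/-- **Multiplicativity of `[K₁ ϖ^m K₁]` for dominant `m`.** For a representation `ρ` of
`GL_n(F)` over a commutative ring, a `K₁`-fixed vector `z` and dominant (antitone)
`m, m' ∈ ℤⁿ`,

`[K₁ ϖ^m K₁] ([K₁ ϖ^{m'} K₁] z) = [K₁ ϖ^{m + m'} K₁] z`

(`heckeOperator` of `HeckeAlgebra`), by `heckeOperator_mul_of_transversal` with `K = K₁`,
`P = B`: Iwahori–Matsumoto (1965), §3, Prop. 3.2 and Th. 3.3 (`S_d S_{d'} = S_{d d'}` in the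
dominant chamber); Casselman (1995), §4.1. [cite: IwahoriMatsumoto1965, §3 Prop. 3.2] -/
theorem heckeOperator_congruenceOne_mul (hϖ : IsUniformizingElement ϖ) {m m' : Fin n → ℤ}
    (hm : Antitone m) (hm' : Antitone m') {z : V}
    (hz : z ∈ ρ.fixedPoints (proUnipotentGL n F (0 : Fin n → Fin 1))) :
    heckeOperator ρ (proUnipotentGL n F (0 : Fin n → Fin 1)) (zpowDiagGL hϖ.ne_zero m)
        (heckeOperator ρ (proUnipotentGL n F (0 : Fin n → Fin 1)) (zpowDiagGL hϖ.ne_zero m') z) =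
      heckeOperator ρ (proUnipotentGL n F (0 : Fin n → Fin 1))
        (zpowDiagGL hϖ.ne_zero (m + m')) z := by
  obtain ⟨s, hs, hbij⟩ := exists_borel_transversal_congruenceOne (n := n) (F := F) hϖ hm
  obtain ⟨s', hs', hbij'⟩ := exists_borel_transversal_congruenceOne (n := n) (F := F) hϖ hm'
  have hmm : Antitone (m + m') := hm.add hm'
  rw [zpowDiagGL_add]
  refine heckeOperator_mul_of_transversal ρ (blockTriangular_zpowDiagGL hϖ.ne_zero m)
    (blockTriangular_zpowDiagGL hϖ.ne_zero m')
    (zpowDiagGL_mul_mul_inv_mem_congruenceOne hϖ hm)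
    (zpowDiagGL_mul_mul_inv_mem_congruenceOne hϖ hm') (fun x hx => ?_) hs hs' hbij hbij'
    (finite_orbit_congruenceOne _) hz
  obtain ⟨b, hbK, -, hb⟩ := exists_upper_mul_zpowDiagGL_coset_eq hϖ hmm hx
  rw [zpowDiagGL_add] at hb
  exact ⟨b, hbK, hb⟩

omit [TopologicalSpace F] [IsNonarchimedeanLocalField F] in
/-- The double-coset operator of `ϖ^0 = 1` is the identity on `V^{K₁}`. [folklore] -/
theorem heckeOperator_congruenceOne_zpowDiagGL_zero (hϖ0 : ϖ ≠ 0) {z : V}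
    (hz : z ∈ ρ.fixedPoints (proUnipotentGL n F (0 : Fin n → Fin 1))) :
    heckeOperator ρ (proUnipotentGL n F (0 : Fin n → Fin 1)) (zpowDiagGL hϖ0 (0 : Fin n → ℤ)) z =
      z := by
  rw [zpowDiagGL_zero]
  exact heckeOperator_one_apply ρ _ hz

end GeneralLinear

end Literature.NumberTheory.Automorphic
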